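import Summits.CriticalPhenomena.PercolationContinuityZ3.Theorems.PercNearOneGluingNoHeavyLowerTailSahiThreeCopyNested

/-!
# `NoHeavyLowerTail` (crux stmt-CriticalPhenomena-4575), Sahi programme: **3C-SAHI FOR THE SLOT
# `C_{2m} = (x₁∨x₂)(x₃∨x₄)⋯(x_{2m−1}∨x_{2m})` AT THE ALL-ONES PROFILE, EVERY `m`** — `c_{1^{2m}}(C_{2m}, G, H) ≥ 0` for ALL
# nonnegative monotone `G, H` on `{0,1}^{2m}`, by a token coupling and an inductive pair lemma; the family contains `C₈ @ 1⁸`, the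
# instance at which the universal sandwich certificate was refuted (`…TwoPointRefutation.not_twoPoint_C8`)

Support file (Sahi cell, seat `prim-sahi-p1`, generation 62; `--supports stmt-CriticalPhenomena-4575`).  Pure proofs plus four
bookkeeping definitions (`cons2`, `hitPairs`, `pt0`, `tokSum`); no `sorry`, standard axioms, nothing computational.
STATEMENT (`tc_hitPairs_nonneg`): pair the coordinates as `(0,1),(2,3),…`; `hitPairs m` = indicator of "every pair is hit"; for every
`m` and all nonnegative monotone `G, H : {0,1}^{2m} → ℝ`, `0 ≤ tc (fun _ => 1) (hitPairs m) G H`, i.e. over the TOKENS (ordered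
3-partitions `(x,y,z)` of the coordinates with `x ∈ C_{2m}`): `2Σ G(x)H(x) + Σ G(y)H(z) ≥ Σ G(y)H(y) + Σ G(x)H(y) + Σ G(y)H(x)`.
HONEST SCOPE: one profile and no further coordinates — NOT universal goodness of `C_{2m}` (memo FROM-prim-sahi-p1-gen62: the
inequality `H` below fails with a free coordinate, a profile-2 pair or an `OR₃` block); 3C-SAHI in general stays OPEN.
PROOF.  (1) `c = [N(fGH;1;1) − N(fH;G;1)] + [A + B − C − D]`, `A = ΣG(x)H(x)`, `B = ΣG(y)H(z)`, `C = ΣG(y)H(y)`, `D = ΣG(x)H(y)`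
(`N3_hitPairs_mul`: the three-copy functionals of `C_{2m}·u` at the all-ones profile are token sums, by `N3_cons_one` twice per pair);
the first bracket is three-copy Harris (`N3_le_N3_mul`).  (2) SWAP IDENTITY `tokSum_swap`: `Σ Φ(y)Ψ(z) = Σ Ψ(y)Φ(s)`, `s = sw z` the
pair-swap of `z` (token bijection `(x,y,z) ↦ ((sw z ∪ y)ᶜ, sw z, y)` = the permutation `N→N, a2→b3, b2→a3, a3→a2, b3→b2` of the five
pair configurations); as `s ⊆ x` along tokens, `A + B − C − D = Σ (G(x) − G(s))(H(x) − H(y)) + Σ G(s)(H(x) − H(s))`.  (3) LEMMA L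
(`tokSum_L`): for `G₁` monotone, `G₂ ≤ G₁`, `H` monotone, `Σ (G₁(x) − G₂(s))(H(x∖s) − H(y)) ≥ 0` — given `z`, the live pairs carry
`(x∩p, y∩p) ∈ {(ab,∅),(a,b),(b,a)}` uniformly, so this is `Σ_X V(X)(W(X) − W(X̄)) ≥ 0` over the sets `X` meeting every live pair;
INDUCTION ON PAIRS: frozen configurations are the hypothesis verbatim, live ones reduce — after applying the hypothesis to the MIXED
sections `(V_s, W_{s̄})` — to the pointwise one-pair inequality `V_{ab}(W_{ab} − W_∅) + (V_a − V_b)(W_a − W_b) ≥ 0` (`pair_ineq`).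
Then `K = Σ (G(x)−G(s))(H(x)−H(y)) ≥ 0` (`tokSum_K_nonneg`), `H := A + B − C − D ≥ 0` (`tokSum_hPart_nonneg`, `N3_hitPairs_hIneq`).
WHY THIS EVADES THE NO-GO of the memo (no induction linear in the five pair statistics of the sections proves 3C or H): the proof
runs through the TWISTED statistics `N(·;·;G∘sw)`, which are not among the five.  [this work]
-/

namespace Summit.CriticalPhenomena.PercolationContinuityZ3.Theorems.SahiThreeCopy
open Finset Function Literature.Combinatorics.Sahi2008
open scoped BigOperators
noncomputable section

/-! ### §1 Pairs of coordinates -/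

/-- Prepend one PAIR of bits `(εa, εb)` to a point of `{0,1}^{2m}`. [this work] -/
def cons2 {m : ℕ} (εa εb : Bool) (x : Pt (2 * m)) : Pt (2 * (m + 1)) :=
  Fin.cons εa (Fin.cons εb x)

/-- `cons2` is monotone in all arguments. [this work] -/
theorem cons2_le_cons2 {m : ℕ} {εa εb εa' εb' : Bool} {x x' : Pt (2 * m)} (ha : εa ≤ εa') (hb : εb ≤ εb')
    (hx : x ≤ x') : cons2 εa εb x ≤ cons2 εa' εb' x' :=
  Fin.cons_le_cons.2 ⟨ha, Fin.cons_le_cons.2 ⟨hb, hx⟩⟩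

/-- `cons2` with a fixed pair is monotone. [this work] -/
theorem cons2_mono {m : ℕ} (εa εb : Bool) : Monotone (cons2 (m := m) εa εb) :=
  fun _ _ h => cons2_le_cons2 le_rfl le_rfl h

/-- **The slot "every pair is hit"**: `C_{2m}(w) = Π_p [w_{a_p} ∨ w_{b_p}]` on `{0,1}^{2m}`, pairs `(2p, 2p+1)`, defined by
peeling the front pair. [this work] -/
def hitPairs : (m : ℕ) → Pt (2 * m) → ℝ
  | 0 => fun _ => 1
  | m + 1 => fun w => (if (w 0 || w 1) then 1 else 0) * hitPairs m (Fin.tail (Fin.tail w))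

/-- `hitPairs` on a prepended pair. [this work] -/
theorem hitPairs_cons2 (m : ℕ) (εa εb : Bool) (x : Pt (2 * m)) :
    hitPairs (m + 1) (cons2 εa εb x) = (if (εa || εb) then 1 else 0) * hitPairs m x := by
  simp only [hitPairs, cons2, Fin.cons_zero, Fin.tail_cons]
  rfl

/-- `hitPairs ≥ 0`. [this work] -/
theorem hitPairs_nonneg : ∀ (m : ℕ) (w : Pt (2 * m)), 0 ≤ hitPairs m w
  | 0, _ => zero_le_one
  | m + 1, w => by
    simp only [hitPairs]
    exact mul_nonneg (by split_ifs <;> norm_num) (hitPairs_nonneg m _)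

/-- `hitPairs` is monotone. [this work] -/
theorem hitPairs_monotone : ∀ (m : ℕ), Monotone (hitPairs m)
  | 0 => fun _ _ _ => le_rfl
  | m + 1 => by
    intro w w' hww'
    simp only [hitPairs]
    refine mul_le_mul ?_ (hitPairs_monotone m (fun i => hww' _)) (hitPairs_nonneg m _) (by split_ifs <;> norm_num)
    have h0 : w 0 ≤ w' 0 := hww' 0; have h1 : w 1 ≤ w' 1 := hww' 1
    by_cases hw : (w 0 || w 1) = true
    · have : (w' 0 || w' 1) = true := by
        rcases Bool.or_eq_true_iff.1 hw with h | h
        · exact Bool.or_eq_true_iff.2 (Or.inl (by revert h0; rw [h]; cases w' 0 <;> simp))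
        · exact Bool.or_eq_true_iff.2 (Or.inr (by revert h1; rw [h]; cases w' 1 <;> simp))
      rw [if_pos hw, if_pos this]
    · rw [if_neg hw]; split_ifs <;> norm_num

/-! ### §2 Token sums over the five pair configurations -/

/-- The base point of `{0,1}^0`. [this work] -/
def pt0 : Pt (2 * 0) := fun i => Fin.elim0 i
/-- **Token sums.**  `tokSum m Φ = Σ_tokens Φ(x, y, z, s, d)` over the TOKENS of `C_{2m}` at the all-ones profile — the ordered
3-partitions `(x,y,z)` of the `2m` coordinates with every pair met by `x` — enriched by `s = sw z` (the pair-swap of `z`, a subset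
of `x`) and `d = x ∖ s`; defined by peeling the front pair over its five configurations
`N: x ∋ a,b`; `a2: x = {b}, y = {a}`; `b2: x = {a}, y = {b}`; `a3: x = {b}, z = {a}, s = {b}`; `b3: x = {a}, z = {b}, s = {a}`. [this work] -/
def tokSum : (m : ℕ) → (Pt (2 * m) → Pt (2 * m) → Pt (2 * m) → Pt (2 * m) → Pt (2 * m) → ℝ) → ℝ
  | 0, Φ => Φ pt0 pt0 pt0 pt0 pt0
  | m + 1, Φ =>
      tokSum m (fun x y z s d => Φ (cons2 true true x) (cons2 false false y) (cons2 false false z) (cons2 false false s)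
        (cons2 true true d)) +
      tokSum m (fun x y z s d => Φ (cons2 false true x) (cons2 true false y) (cons2 false false z) (cons2 false false s)
        (cons2 false true d)) +
      tokSum m (fun x y z s d => Φ (cons2 true false x) (cons2 false true y) (cons2 false false z) (cons2 false false s)
        (cons2 true false d)) +
      tokSum m (fun x y z s d => Φ (cons2 false true x) (cons2 false false y) (cons2 true false z) (cons2 false true s)
        (cons2 false false d)) +
      tokSum m (fun x y z s d => Φ (cons2 true false x) (cons2 false false y) (cons2 false true z) (cons2 true false s)
        (cons2 false false d))

variable {m : ℕ}

/-- `tokSum` is additive. [this work] -/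
theorem tokSum_add : ∀ (m : ℕ) (Φ Ψ : Pt (2 * m) → Pt (2 * m) → Pt (2 * m) → Pt (2 * m) → Pt (2 * m) → ℝ),
    tokSum m (fun x y z s d => Φ x y z s d + Ψ x y z s d) = tokSum m Φ + tokSum m Ψ
  | 0, _, _ => rfl
  | m + 1, Φ, Ψ => by
    simp only [tokSum]
    rw [tokSum_add m, tokSum_add m, tokSum_add m, tokSum_add m, tokSum_add m]
    ring

/-- `tokSum` is subtractive. [this work] -/
theorem tokSum_sub : ∀ (m : ℕ) (Φ Ψ : Pt (2 * m) → Pt (2 * m) → Pt (2 * m) → Pt (2 * m) → Pt (2 * m) → ℝ),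
    tokSum m (fun x y z s d => Φ x y z s d - Ψ x y z s d) = tokSum m Φ - tokSum m Ψ
  | 0, _, _ => rfl
  | m + 1, Φ, Ψ => by
    simp only [tokSum]
    rw [tokSum_sub m, tokSum_sub m, tokSum_sub m, tokSum_sub m, tokSum_sub m]
    ring

/-- ★ **Positivity on valid tokens**: along every token `s ≤ x` and `d ≤ x` coordinatewise, so a pointwise nonnegative
integrand on such tuples has a nonnegative token sum. [this work] -/
theorem tokSum_nonneg : ∀ (m : ℕ) (Φ : Pt (2 * m) → Pt (2 * m) → Pt (2 * m) → Pt (2 * m) → Pt (2 * m) → ℝ),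
    (∀ x y z s d, s ≤ x → d ≤ x → 0 ≤ Φ x y z s d) → 0 ≤ tokSum m Φ
  | 0, _, hΦ => hΦ _ _ _ _ _ le_rfl le_rfl
  | m + 1, Φ, hΦ => by
    simp only [tokSum]
    have bt : (false : Bool) ≤ true := Bool.false_le _
    refine add_nonneg (add_nonneg (add_nonneg (add_nonneg ?_ ?_) ?_) ?_) ?_ <;>
      refine tokSum_nonneg m _ (fun x y z s d hs hd => hΦ _ _ _ _ _ ?_ ?_)
    · exact cons2_le_cons2 bt bt hs
    · exact cons2_le_cons2 le_rfl le_rfl hd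
    · exact cons2_le_cons2 le_rfl bt hs
    · exact cons2_le_cons2 le_rfl le_rfl hd
    · exact cons2_le_cons2 bt le_rfl hs
    · exact cons2_le_cons2 le_rfl le_rfl hd
    · exact cons2_le_cons2 le_rfl le_rfl hs
    · exact cons2_le_cons2 le_rfl bt hd
    · exact cons2_le_cons2 le_rfl le_rfl hs
    · exact cons2_le_cons2 bt le_rfl hd

/-- ★★ **The swap identity** (the coupling `θ`): for all `Φ, Ψ`, `Σ_tok Φ(y)Ψ(z) = Σ_tok Ψ(y)Φ(s)` — the pairs `(E₂, E₃)` and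
`(sw E₃, E₂)` of a uniform token are equidistributed.  Per pair this is the permutation `N→N, a2→b3, b2→a3, a3→a2, b3→b2` of the
five configurations. [this work] -/
theorem tokSum_swap : ∀ (m : ℕ) (Φ Ψ : Pt (2 * m) → ℝ),
    tokSum m (fun _ y z _ _ => Φ y * Ψ z) = tokSum m (fun _ y _ s _ => Ψ y * Φ s)
  | 0, _, _ => by simp only [tokSum]; ring
  | m + 1, Φ, Ψ => by
    simp only [tokSum]
    have h1 : tokSum m (fun _ y z _ _ => Φ (cons2 false false y) * Ψ (cons2 false false z)) =
        tokSum m (fun _ y _ s _ => Ψ (cons2 false false y) * Φ (cons2 false false s)) := tokSum_swap m _ _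
    have h2 : tokSum m (fun _ y z _ _ => Φ (cons2 true false y) * Ψ (cons2 false false z)) =
        tokSum m (fun _ y _ s _ => Ψ (cons2 false false y) * Φ (cons2 true false s)) := tokSum_swap m _ _
    have h3 : tokSum m (fun _ y z _ _ => Φ (cons2 false true y) * Ψ (cons2 false false z)) =
        tokSum m (fun _ y _ s _ => Ψ (cons2 false false y) * Φ (cons2 false true s)) := tokSum_swap m _ _
    have h4 : tokSum m (fun _ y z _ _ => Φ (cons2 false false y) * Ψ (cons2 true false z)) =
        tokSum m (fun _ y _ s _ => Ψ (cons2 true false y) * Φ (cons2 false false s)) := tokSum_swap m _ _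
    have h5 : tokSum m (fun _ y z _ _ => Φ (cons2 false false y) * Ψ (cons2 false true z)) =
        tokSum m (fun _ y _ s _ => Ψ (cons2 false true y) * Φ (cons2 false false s)) := tokSum_swap m _ _
    rw [h1, h2, h3, h4, h5]
    ring

/-! ### §3 The elementary pair inequality and Lemma L -/

/-- The one-pair inequality: `c(w − e) + (p − q)(u − v) ≥ 0` when `0 ≤ a ≤ p, q ≤ c` and `e ≤ u, v ≤ w`. [this work] -/
theorem pair_ineq {a p q c e u v w : ℝ} (ha : 0 ≤ a) (hap : a ≤ p) (haq : a ≤ q) (hpc : p ≤ c) (hqc : q ≤ c)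
    (heu : e ≤ u) (hev : e ≤ v) (huw : u ≤ w) (hvw : v ≤ w) : 0 ≤ c * (w - e) + (p - q) * (u - v) := by
  rcases le_total q p with hqp | hpq
  · rcases le_total v u with hvu | huv
    · exact add_nonneg (mul_nonneg (by linarith) (by linarith)) (mul_nonneg (by linarith) (by linarith))
    · have h1 : c * (u - v) ≤ (p - q) * (u - v) :=
        mul_le_mul_of_nonpos_right (by linarith) (by linarith)
      have h2 : c * (e - w) ≤ c * (u - v) := mul_le_mul_of_nonneg_left (by linarith) (by linarith)
      nlinarith
  · rcases le_total v u with hvu | huv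
    · have h1 : (q - p) * (v - u) ≥ c * (v - u) :=
        mul_le_mul_of_nonpos_right (by linarith) (by linarith)
      have h2 : c * (e - w) ≤ c * (v - u) := mul_le_mul_of_nonneg_left (by linarith) (by linarith)
      nlinarith
    · exact add_nonneg (mul_nonneg (by linarith) (by linarith)) (mul_nonneg_of_nonpos_of_nonpos (by linarith) (by linarith))

/-- ★★ **Lemma L (inductive form).**  For `G₁` monotone, `G₂ ≤ G₁` pointwise and `H` monotone:
`Σ_tok (G₁(x) − G₂(s))·(H(d) − H(y)) ≥ 0`.  (Tokens with a fixed `z`: `x = s ⊔ X`, `d = X`, `y = X̄` with `X` uniform on the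
nonempty traces of the untouched pairs; this is `Σ_X V(X)(W(X) − W(X̄)) ≥ 0` for `V = G₁(s ∪ ·) − G₂(s)`, `W = H`, proved by
peeling pairs: the frozen configurations are the induction hypothesis verbatim, the live ones reduce — after one more use of the
induction hypothesis on the mixed sections — to `pair_ineq` pointwise.) [this work] -/
theorem tokSum_L : ∀ (m : ℕ) (G₁ G₂ H : Pt (2 * m) → ℝ), Monotone G₁ → (∀ x, G₂ x ≤ G₁ x) → Monotone H →
    0 ≤ tokSum m (fun x y _ s d => (G₁ x - G₂ s) * (H d - H y))
  | 0, G₁, G₂, H, _, _, _ => by simp only [tokSum, sub_self, mul_zero]; exact le_rfl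
  | m + 1, G₁, G₂, H, hG₁, hG₂₁, hH => by
    simp only [tokSum]
    have mG : ∀ εa εb, Monotone (fun x => G₁ (cons2 εa εb x)) := fun εa εb _ _ h => hG₁ (cons2_mono εa εb h)
    have mH : ∀ εa εb, Monotone (fun x => H (cons2 εa εb x)) := fun εa εb _ _ h => hH (cons2_mono εa εb h)
    have bt : (false : Bool) ≤ true := Bool.false_le _
    have le00 : ∀ εa εb (x : Pt (2 * m)), G₂ (cons2 false false x) ≤ G₁ (cons2 εa εb x) :=
      fun εa εb x => (hG₂₁ _).trans (hG₁ (cons2_le_cons2 (Bool.false_le _) (Bool.false_le _) le_rfl))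
    have T4 : 0 ≤ tokSum m (fun x y _ s d => (G₁ (cons2 false true x) - G₂ (cons2 false true s)) *
        (H (cons2 false false d) - H (cons2 false false y))) :=
      tokSum_L m _ _ _ (mG false true) (fun x => hG₂₁ _) (mH false false)
    have T5 : 0 ≤ tokSum m (fun x y _ s d => (G₁ (cons2 true false x) - G₂ (cons2 true false s)) *
        (H (cons2 false false d) - H (cons2 false false y))) :=
      tokSum_L m _ _ _ (mG true false) (fun x => hG₂₁ _) (mH false false)
    have S1 : 0 ≤ tokSum m (fun x y _ s d => (G₁ (cons2 true true x) - G₂ (cons2 false false s)) *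
        (H (cons2 false false d) - H (cons2 false false y))) :=
      tokSum_L m _ _ _ (mG true true) (le00 true true) (mH false false)
    have S2 : 0 ≤ tokSum m (fun x y _ s d => (G₁ (cons2 false true x) - G₂ (cons2 false false s)) *
        (H (cons2 true false d) - H (cons2 true false y))) :=
      tokSum_L m _ _ _ (mG false true) (le00 false true) (mH true false)
    have S3 : 0 ≤ tokSum m (fun x y _ s d => (G₁ (cons2 true false x) - G₂ (cons2 false false s)) *
        (H (cons2 false true d) - H (cons2 false true y))) :=
      tokSum_L m _ _ _ (mG true false) (le00 true false) (mH false true)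
    have P0 : 0 ≤ tokSum m (fun x _ _ s d =>
        (G₁ (cons2 true true x) - G₂ (cons2 false false s)) * (H (cons2 true true d) - H (cons2 false false d)) +
        ((G₁ (cons2 false true x) - G₂ (cons2 false false s)) - (G₁ (cons2 true false x) - G₂ (cons2 false false s))) *
          (H (cons2 false true d) - H (cons2 true false d))) := by
      refine tokSum_nonneg m _ (fun x y z s d hs _ => ?_)
      have hss : G₂ (cons2 false false s) ≤ G₁ (cons2 false false x) :=
        (hG₂₁ _).trans (hG₁ (cons2_le_cons2 le_rfl le_rfl hs))
      exact pair_ineq (a := G₁ (cons2 false false x) - G₂ (cons2 false false s)) (sub_nonneg.2 hss)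
        (sub_le_sub_right (hG₁ (cons2_le_cons2 le_rfl bt le_rfl)) _)
        (sub_le_sub_right (hG₁ (cons2_le_cons2 bt le_rfl le_rfl)) _)
        (sub_le_sub_right (hG₁ (cons2_le_cons2 bt le_rfl le_rfl)) _)
        (sub_le_sub_right (hG₁ (cons2_le_cons2 le_rfl bt le_rfl)) _)
        (hH (cons2_le_cons2 le_rfl bt le_rfl)) (hH (cons2_le_cons2 bt le_rfl le_rfl))
        (hH (cons2_le_cons2 bt le_rfl le_rfl)) (hH (cons2_le_cons2 le_rfl bt le_rfl))
    have e1 : tokSum m (fun x y _ s d => (G₁ (cons2 true true x) - G₂ (cons2 false false s)) *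
          (H (cons2 true true d) - H (cons2 false false y))) =
        tokSum m (fun x _ _ s d => (G₁ (cons2 true true x) - G₂ (cons2 false false s)) *
          (H (cons2 true true d) - H (cons2 false false d))) +
        tokSum m (fun x y _ s d => (G₁ (cons2 true true x) - G₂ (cons2 false false s)) *
          (H (cons2 false false d) - H (cons2 false false y))) := by
      rw [← tokSum_add]; congr 1; funext x y z s d; ring
    have e2 : tokSum m (fun x y _ s d => (G₁ (cons2 false true x) - G₂ (cons2 false false s)) *
          (H (cons2 false true d) - H (cons2 true false y))) =
        tokSum m (fun x _ _ s d => (G₁ (cons2 false true x) - G₂ (cons2 false false s)) *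
          (H (cons2 false true d) - H (cons2 true false d))) +
        tokSum m (fun x y _ s d => (G₁ (cons2 false true x) - G₂ (cons2 false false s)) *
          (H (cons2 true false d) - H (cons2 true false y))) := by
      rw [← tokSum_add]; congr 1; funext x y z s d; ring
    have e3 : tokSum m (fun x y _ s d => (G₁ (cons2 true false x) - G₂ (cons2 false false s)) *
          (H (cons2 true false d) - H (cons2 false true y))) =
        tokSum m (fun x _ _ s d => (G₁ (cons2 true false x) - G₂ (cons2 false false s)) *
          (H (cons2 true false d) - H (cons2 false true d))) +
        tokSum m (fun x y _ s d => (G₁ (cons2 true false x) - G₂ (cons2 false false s)) *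
          (H (cons2 false true d) - H (cons2 false true y))) := by
      rw [← tokSum_add]; congr 1; funext x y z s d; ring
    have e0 : tokSum m (fun x _ _ s d => (G₁ (cons2 true true x) - G₂ (cons2 false false s)) *
          (H (cons2 true true d) - H (cons2 false false d))) +
        tokSum m (fun x _ _ s d => (G₁ (cons2 false true x) - G₂ (cons2 false false s)) *
          (H (cons2 false true d) - H (cons2 true false d))) +
        tokSum m (fun x _ _ s d => (G₁ (cons2 true false x) - G₂ (cons2 false false s)) *
          (H (cons2 true false d) - H (cons2 false true d))) =
        tokSum m (fun x _ _ s d =>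
          (G₁ (cons2 true true x) - G₂ (cons2 false false s)) * (H (cons2 true true d) - H (cons2 false false d)) +
          ((G₁ (cons2 false true x) - G₂ (cons2 false false s)) - (G₁ (cons2 true false x) - G₂ (cons2 false false s))) *
            (H (cons2 false true d) - H (cons2 true false d))) := by
      rw [← tokSum_add, ← tokSum_add]; congr 1; funext x y z s d; ring
    rw [e1, e2, e3]
    nlinarith [P0, S1, S2, S3, T4, T5, e0]

/-! ### §4 The `K`-term and the `H`-part -/

/-- ★ `K = Σ_tok (G(x) − G(s))(H(x) − H(y)) ≥ 0` for monotone `G, H`: split `H(x) − H(y) = [H(x) − H(d)] + [H(d) − H(y)]`; the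
first part is nonnegative termwise (`s, d ≤ x`), the second is Lemma L with `G₁ = G₂ = G`. [this work] -/
theorem tokSum_K_nonneg (m : ℕ) {G H : Pt (2 * m) → ℝ} (hGm : Monotone G) (hHm : Monotone H) :
    0 ≤ tokSum m (fun x y _ s _ => (G x - G s) * (H x - H y)) := by
  have e : tokSum m (fun x y _ s _ => (G x - G s) * (H x - H y)) =
      tokSum m (fun x _ _ s d => (G x - G s) * (H x - H d)) + tokSum m (fun x y _ s d => (G x - G s) * (H d - H y)) := by
    rw [← tokSum_add]; congr 1; funext x y z s d; ring
  rw [e]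
  refine add_nonneg (tokSum_nonneg m _ fun x y z s d hs hd => ?_) (tokSum_L m G G H hGm (fun _ => le_rfl) hHm)
  exact mul_nonneg (sub_nonneg.2 (hGm hs)) (sub_nonneg.2 (hHm hd))

/-- ★★ **The `H`-inequality in token form**: for `G ≥ 0` monotone and `H` monotone,
`Σ G(x)H(x) + Σ G(y)H(z) − Σ G(y)H(y) − Σ G(x)H(y) ≥ 0` — by the swap identity the middle two sums are `Σ H(y)G(s)` and
`Σ G(s)H(s)`, and the whole is `K + Σ G(s)(H(x) − H(s))`. [this work] -/
theorem tokSum_hPart_nonneg (m : ℕ) {G H : Pt (2 * m) → ℝ} (hG : ∀ x, 0 ≤ G x) (hGm : Monotone G) (hHm : Monotone H) :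
    0 ≤ tokSum m (fun x _ _ _ _ => G x * H x) + tokSum m (fun _ y z _ _ => G y * H z) -
      tokSum m (fun _ y _ _ _ => G y * H y) - tokSum m (fun x y _ _ _ => G x * H y) := by
  have eB : tokSum m (fun _ y z _ _ => G y * H z) = tokSum m (fun _ y _ s _ => H y * G s) := tokSum_swap m G H
  have eC : tokSum m (fun _ y _ _ _ => G y * H y) = tokSum m (fun _ _ _ s _ => G s * H s) := by
    have h := tokSum_swap m (fun y => G y * H y) (fun _ => 1)
    simp only [mul_one, one_mul] at h
    exact h
  rw [eB, eC]
  have e : tokSum m (fun x _ _ _ _ => G x * H x) + tokSum m (fun _ y _ s _ => H y * G s) -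
      tokSum m (fun _ _ _ s _ => G s * H s) - tokSum m (fun x y _ _ _ => G x * H y) =
      tokSum m (fun x y _ s _ => (G x - G s) * (H x - H y)) + tokSum m (fun x _ _ s _ => G s * (H x - H s)) := by
    rw [← tokSum_add, ← tokSum_sub, ← tokSum_sub, ← tokSum_add]; congr 1; funext x y z s d; ring
  rw [e]
  refine add_nonneg (tokSum_K_nonneg m hGm hHm) (tokSum_nonneg m _ fun x y z s d hs _ => ?_)
  exact mul_nonneg (hG _) (sub_nonneg.2 (hHm hs))

/-! ### §5 The bridge: three-copy functionals of the slot `C_{2m}` at the all-ones profile are token sums -/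

/-- The all-ones profile on `2m + 2` coordinates, peeled twice. [this work] -/
theorem profile_one_succ (m : ℕ) :
    (fun _ : Fin (2 * (m + 1)) => (1 : ℕ)) =
      (Fin.cons 1 (Fin.cons 1 (fun _ : Fin (2 * m) => (1 : ℕ))) : Fin (2 * m + 1 + 1) → ℕ) := by
  funext i
  refine Fin.cases ?_ (fun j => ?_) i
  · rfl
  · refine Fin.cases ?_ (fun j' => ?_) j <;> rfl

/-- Double sections are sections at a pair. [this work] -/
theorem sec_sec {m : ℕ} (F : Pt (2 * (m + 1)) → ℝ) (εa εb : Bool) : sec (sec F εa) εb = fun x => F (cons2 εa εb x) := rfl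

/-- Pair sections of `C_{2m+2} · u`: the token configurations keep `C_{2m} · u(cons2 …)`, the others vanish. [this work] -/
theorem hitPairs_mul_cons2 (m : ℕ) (u : Pt (2 * (m + 1)) → ℝ) (εa εb : Bool) :
    (fun x => (hitPairs (m + 1) * u) (cons2 εa εb x)) =
      (if (εa || εb) then (1 : ℝ) else 0) • (hitPairs m * fun x => u (cons2 εa εb x)) := by
  funext x
  simp only [Pi.mul_apply, Pi.smul_apply, smul_eq_mul, hitPairs_cons2]
  ring


/-- ★★ **Bridge.**  `N_{1^{2m}}(C_{2m}·u; v; w) = Σ_tok u(x) v(y) w(z)`. [this work] -/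
theorem N3_hitPairs_mul : ∀ (m : ℕ) (u v w : Pt (2 * m) → ℝ),
    N3 (fun _ => 1) (hitPairs m * u) v w = tokSum m (fun x y z _ _ => u x * v y * w z)
  | 0, u, v, w => by
    rw [N3_dim_zero]
    simp only [tokSum, Pi.mul_apply, hitPairs, one_mul]
    rfl
  | m + 1, u, v, w => by
    rw [profile_one_succ, N3_cons_one, N3_cons_one, N3_cons_one, N3_cons_one]
    simp only [sec_sec, hitPairs_mul_cons2, Bool.or_false, Bool.or_true, Bool.false_eq_true, if_true,
      if_false, one_smul, zero_smul, N3_zero_left, N3_hitPairs_mul m, add_zero]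
    simp only [tokSum]
    ring

/-- The bridge with a trivial `u`. [this work] -/
theorem N3_hitPairs (m : ℕ) (v w : Pt (2 * m) → ℝ) :
    N3 (fun _ => 1) (hitPairs m) v w = tokSum m (fun _ y z _ _ => v y * w z) := by
  have h := N3_hitPairs_mul m 1 v w
  rw [mul_one] at h
  rw [h]; simp only [Pi.one_apply, one_mul]

/-! ### §6 The theorem -/

/-- ★★ **The inequality `H` for `C_{2m}` at the all-ones profile**: `N(fGH;1;1) + N(f;G;H) ≥ N(f;GH;1) + N(fG;H;1)` for
`f = hitPairs m`, `G ≥ 0` monotone, `H` monotone (token form `tokSum_hPart_nonneg`).  Stronger than 3C by a Harris gap; special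
to this slot/profile (it fails with a free coordinate). [this work] -/
theorem N3_hitPairs_hIneq (m : ℕ) {G H : Pt (2 * m) → ℝ} (hG : ∀ x, 0 ≤ G x) (hGm : Monotone G) (hHm : Monotone H) :
    N3 (fun _ => 1) (hitPairs m) (G * H) 1 + N3 (fun _ => 1) (hitPairs m * G) H 1 ≤
      N3 (fun _ => 1) (hitPairs m * G * H) 1 1 + N3 (fun _ => 1) (hitPairs m) G H := by
  have eA : N3 (fun _ => 1) (hitPairs m * G * H) 1 1 = tokSum m (fun x _ _ _ _ => G x * H x) := by
    rw [mul_assoc, N3_hitPairs_mul]; simp only [Pi.mul_apply, Pi.one_apply, mul_one]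
  have eC : N3 (fun _ => 1) (hitPairs m) (G * H) 1 = tokSum m (fun _ y _ _ _ => G y * H y) := by
    rw [N3_hitPairs]; simp only [Pi.mul_apply, Pi.one_apply, mul_one]
  have eD : N3 (fun _ => 1) (hitPairs m * G) H 1 = tokSum m (fun x y _ _ _ => G x * H y) := by
    rw [N3_hitPairs_mul]; simp only [Pi.one_apply, mul_one]
  have hp := tokSum_hPart_nonneg m hG hGm hHm
  rw [eA, N3_hitPairs m G H, eC, eD]; linarith


/-- ★★★ **3C-SAHI for the slot `C_{2m} = (x₁∨x₂)(x₃∨x₄)⋯(x_{2m−1}∨x_{2m})` at the all-ones profile, every `m`.**  For all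
nonnegative monotone `G, H : {0,1}^{2m} → ℝ`:  `0 ≤ c_{1^{2m}}(C_{2m}, G, H)` — the tensor-Bernstein coefficient of Sahi's `E₃`
in multidegree `(1,…,1)` for the triple (every pair is hit, `G`, `H`).  Proof: `c = [N(fGH;1;1) − N(fH;G;1)] + [Σ G(x)H(x) +
Σ G(y)H(z) − Σ G(y)H(y) − Σ G(x)H(y)]`, the first bracket a three-copy Harris gap (`N3_le_N3_mul`), the second
`tokSum_hPart_nonneg` (swap identity + Lemma L). [this work] -/
theorem tc_hitPairs_nonneg (m : ℕ) {G H : Pt (2 * m) → ℝ} (hG : ∀ x, 0 ≤ G x) (hH : ∀ x, 0 ≤ H x) (hGm : Monotone G)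
    (hHm : Monotone H) : 0 ≤ tc (fun _ => 1) (hitPairs m) G H := by
  have hf : ∀ x, 0 ≤ hitPairs m x := hitPairs_nonneg m
  have hfH : ∀ x, 0 ≤ (hitPairs m * H) x := fun x => mul_nonneg (hf x) (hH x)
  have hfHm : Monotone (hitPairs m * H) := (hitPairs_monotone m).mul hHm hf hH
  have harris : N3 (fun _ => 1) (hitPairs m * H) G 1 ≤ N3 (fun _ => 1) (hitPairs m * G * H) 1 1 := by
    have h := N3_le_N3_mul (2 * m) (fun _ => 1) (hitPairs m * H) G 1 hfH hfHm hG hGm (fun _ => zero_le_one)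
    rwa [mul_right_comm] at h
  have eA : N3 (fun _ => 1) (hitPairs m * G * H) 1 1 = tokSum m (fun x _ _ _ _ => G x * H x) := by
    rw [mul_assoc, N3_hitPairs_mul]; simp only [Pi.mul_apply, Pi.one_apply, mul_one]
  have eB : N3 (fun _ => 1) (hitPairs m) G H = tokSum m (fun _ y z _ _ => G y * H z) := N3_hitPairs m G H
  have eC : N3 (fun _ => 1) (hitPairs m) (G * H) 1 = tokSum m (fun _ y _ _ _ => G y * H y) := by
    rw [N3_hitPairs]; simp only [Pi.mul_apply, Pi.one_apply, mul_one]
  have eD : N3 (fun _ => 1) (hitPairs m * G) H 1 = tokSum m (fun x y _ _ _ => G x * H y) := by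
    rw [N3_hitPairs_mul]; simp only [Pi.one_apply, mul_one]
  have eD' : N3 (fun _ => 1) (hitPairs m * H) G 1 = tokSum m (fun x y _ _ _ => H x * G y) := by
    rw [N3_hitPairs_mul]; simp only [Pi.one_apply, mul_one]
  have hp := tokSum_hPart_nonneg m hG hGm hHm
  unfold tc
  rw [N3_comm12 _ G (hitPairs m * H) 1, N3_comm12 _ H (hitPairs m * G) 1, eA, eB, eC, eD, eD']
  rw [eA, eD'] at harris; linarith

/-- The indicator form: for all up-sets `B, C ⊆ {0,1}^{2m}`, `0 ≤ c_{1^{2m}}(C_{2m}, 1_B, 1_C)`. [this work] -/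
theorem tc_hitPairs_setInd_nonneg (m : ℕ) {B C : Finset (Pt (2 * m))} (hB : IsUpperSet (B : Set (Pt (2 * m))))
    (hC : IsUpperSet (C : Set (Pt (2 * m)))) : 0 ≤ tc (fun _ => 1) (hitPairs m) (setInd B) (setInd C) :=
  tc_hitPairs_nonneg m (setInd_nonneg B) (setInd_nonneg C) (monotone_setInd hB) (monotone_setInd hC)

end

end Summit.CriticalPhenomena.PercolationContinuityZ3.Theorems.SahiThreeCopy
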